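import Mathlib
import HarnessLib
import Summits.HubbardSuperconductivity.HubbardSuperconductivity.Theorems.KLProgrammeKLRegimeSectorOverlapDefectFrames

/-!
# Route `KLProgramme` — VL child `KLRegimeVolumeLimitV17F2` (stmt-HubbardSuperconductivity-20440), closer MODEL file M2 «MISMATCH-SLICE», bracket (c),
# RATE FORM: the `δ` of the re-sectorisation frame defect is `≤ C·ε` with `C` free of `(L, M, K, K′)` — the currency of the two-volume Tannery step

Cell `gate-hubbard-kl`, seat hubbard-kl-k3c4-p2 (g12; UV / Matsubara all-U lane).  Part 4 of bracket (c) (`…SectorOverlapDefectFrames`, p585646)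
bounds the full row / column sums of `E(F_{n₁}[K′])·S(F̃_{n₂}[K′]) − E(F_{n₁}[K])·S(F̃_{n₂}[K])` by a closed form still carrying free rates `s₀, s₁`,
the angular `C²` sizes `z₁, z₂` of the sector pair and a raw growth `∝ 2M` before the time weight.  The consumer (VL M5 spine, per-scale bracket (ii) =
`TwoVolumeDefect.sum_pinned_norm_kernel_map_sub_map_le` p572182, hypotheses `hδcol/hδrow` on `T_{L″}[K′] − T_{L″}[K]`, `T = imagTimeWeight β M • E·S`
as in `sector_sum_norm_kernel_twoVolume_scaleSucc_le` p581610) needs that `δ` UNIFORM in `M` at fixed `L` and `O(ε)`, `ε = (Σ_{i≤2} c_i(n⋆))/L` on the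
two volumes' top frames (p579274).  This file does the bookkeeping once and for all:

* §1 `overlapDefect_rate_final` (last algebra: `β/(2M)·54·2^k·(1/(βL²))·3·P·((2M+1)L²)·ε ≤ 324·2^k·P·ε`), `norm_real_smul_apply_sub`;
* §2 `exists_uniform_angularFactor_derivBounds` (the `C²` sizes of p4's angular factors, uniform over the finitely many sector pairs);
* §3 `thinPairDiff_amp_linear` (the amplitude of `…FrameDiffsL1.sum_norm_charSum_thinPairDiff_le` at the rates `s₀ := 1/(2M)`, `s₁ := 1` is
  EXACTLY linear in `ε`, coefficient `(L, M)`-free) and **`thinPairDiff_rate_core`** (`∃ P ≥ 0` free of `(L, M, ε)`: the thin-pair `ℓ¹` bound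
  `≤ P·((2M+1)·L²)·ε` — the counting factor `√(16·2M·L²·N̄_s) ≤ √(…)·(2M+1)·L²`);
* §4 **`exists_overlapDefect_rate_of_frames`**: `∃ C ≥ 0` depending only on `(β, B, e₀, z, μ, A, d, n₁, n₂)` with, for ALL `L, M ≥ 1`, all frame
  pairs with `C²` size `A`, all `ε` above the frame increment, under the two eventual conditions `Λ_{n₁}β < π(2M−3)` and `4π ≤ zL`:
  `imagTimeWeight β M · Σ_Y ‖Δ(Y′,Y)‖ ≤ C·ε` and `imagTimeWeight β M · Σ_{Y′} ‖Δ(Y′,Y)‖ ≤ C·ε`;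
  **`exists_transfer_frameDefect_rate`**: the same in p572182's literal currency — `∀ y, Σ_x ‖T[K′] x y − T[K] x y‖ ≤ C·ε` and the pin rows —
  for `T[K] = ((imagTimeWeight β M : ℝ) : ℂ) • (E(klAniso[K] n₁)·S(bgmFat[K] n₂))`.

Proofs only; no definitions, no named facts; no rate / angular size / `M`-growth left in the interface. [folklore] BGM 2006 §2.7 (2.71a), §3 (3.3).
-/

noncomputable section

namespace Summit.HubbardSuperconductivity.HubbardSuperconductivity.Theorems.TorusFourierL2

set_option linter.dupNamespace false -- summit = problem name (single-conjunct summit), D-0017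

open Set Finset Literature.MathematicalPhysics.QuantumLattice Literature.MathematicalPhysics.QuantumLattice.BandSectorCounting
open Literature.MathematicalPhysics.QuantumLattice.FermiRG Literature.Probability.LatticeModels Literature.Analysis.SpecialFunctions
open Summit.HubbardSuperconductivity.HubbardSuperconductivity.Theorems.DispersionFlow
open Summit.HubbardSuperconductivity.HubbardSuperconductivity.Theorems.KLRegimeSplit
open Summit.HubbardSuperconductivity.HubbardSuperconductivity.Theorems.KLProgrammeLegKernels
open Summit.HubbardSuperconductivity.HubbardSuperconductivity.Theorems.EngineV8
open Summit.HubbardSuperconductivity.HubbardSuperconductivity.Theorems.PerturbedFermiCurve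
open scoped Real

/-- **The last algebra of the rate form**: for `c ≤ 54·2^k`, `imagTimeWeight β M · (c · (1/(βL²)) · 3 · (P·((2M+1)·L²)·ε)) ≤ 324·2^k·P·ε`
(`β` and `L²` cancel, `(2M+1)/(2M) ≤ 2`). [folklore] -/
theorem overlapDefect_rate_final {β L P ε : ℝ} {M c k : ℕ} (hM : 0 < M) (hc : (c : ℝ) ≤ 54 * 2 ^ k) (hβ : 0 < β) (hL : 0 < L)
    (hP : 0 ≤ P) (hε : 0 ≤ ε) :
    imagTimeWeight β M * ((c : ℝ) * (1 / (β * L ^ 2) * (3 * (P * ((((2 * M : ℕ) : ℝ) + 1) * L ^ 2) * ε)))) ≤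
      324 * 2 ^ k * P * ε := by
  rw [imagTimeWeight]
  have hM' : (0 : ℝ) < M := Nat.cast_pos.2 hM
  have hM1 : (1 : ℝ) ≤ M := by exact_mod_cast hM
  have e : β / (2 * (M : ℝ)) * ((c : ℝ) * (1 / (β * L ^ 2) * (3 * (P * ((((2 * M : ℕ) : ℝ) + 1) * L ^ 2) * ε)))) =
      3 * c * P * ε * ((2 * M + 1) / (2 * M)) := by
    push_cast
    field_simp
  rw [e]
  have h1 : ((2 : ℝ) * M + 1) / (2 * M) ≤ 2 := by
    rw [div_le_iff₀ (by positivity)]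
    linarith
  calc 3 * (c : ℝ) * P * ε * ((2 * M + 1) / (2 * M)) ≤ 3 * (c : ℝ) * P * ε * 2 := by gcongr
    _ = 6 * (c : ℝ) * (P * ε) := by ring
    _ ≤ 6 * (54 * 2 ^ k) * (P * ε) := by gcongr
    _ = 324 * 2 ^ k * P * ε := by ring

/-- **Pulling a nonnegative real scalar out of an entrywise matrix difference**: `‖(t•A′) i j − (t•A) i j‖ = t·‖(A′ − A) i j‖` for `0 ≤ t`.
[folklore] -/
theorem norm_real_smul_apply_sub {I J : Type*} (A' A : Matrix I J ℂ) {t : ℝ} (ht : 0 ≤ t) (i : I) (j : J) :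
    ‖((t : ℂ) • A') i j - ((t : ℂ) • A) i j‖ = t * ‖(A' - A) i j‖ := by
  rw [Matrix.smul_apply, Matrix.smul_apply, smul_eq_mul, smul_eq_mul, ← mul_sub, norm_mul, Complex.norm_real, Real.norm_eq_abs,
    abs_of_nonneg ht, Matrix.sub_apply]

/-! ## §2 Uniform `C²` sizes of the angular factors -/

/-- **Uniform global `C²` bounds of p4's angular factors over the finitely many sector pairs**: `∃ z₁ z₂ ≥ 0` (depending on `(z, n₁, n₂)` only)
bounding `‖DZ_{ω₁ω₂}‖`, `‖D²Z_{ω₁ω₂}‖` everywhere (`…FrameDiffData.exists_angularFactor_derivBounds` pair by pair, then the sum over the pairs). [folklore] -/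
theorem exists_uniform_angularFactor_derivBounds {z : ℝ} (hz : 0 < z) (n₁ n₂ : ℕ) :
    ∃ z₁ z₂ : ℝ, 0 ≤ z₁ ∧ 0 ≤ z₂ ∧
      (∀ (ω₁ : Fin (sectorCount n₁)) (ω₂ : Fin (sectorCount n₂)) (p : Fin 2 → ℝ),
        ‖fderiv ℝ (fun p : Fin 2 → ℝ =>
          gnCutoff ((π + z) ^ 2 / π ^ 2) ((π + z) ^ 2) (p 0 ^ 2) * gnCutoff ((π + z) ^ 2 / π ^ 2) ((π + z) ^ 2) (p 1 ^ 2) *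
          ((radialCutoffC (1 / 2) (momToComplex p) * sectorWeightCirc n₁ ((ω₁ : ℕ) : ℤ) (polarAngle p)) *
            (radialCutoffC (1 / 2) (momToComplex p) * sectorWeightCirc n₂ ((ω₂ : ℕ) : ℤ) (polarAngle p)))) p‖ ≤ z₁) ∧
      (∀ (ω₁ : Fin (sectorCount n₁)) (ω₂ : Fin (sectorCount n₂)) (p : Fin 2 → ℝ),
        ‖iteratedFDeriv ℝ 2 (fun p : Fin 2 → ℝ =>
          gnCutoff ((π + z) ^ 2 / π ^ 2) ((π + z) ^ 2) (p 0 ^ 2) * gnCutoff ((π + z) ^ 2 / π ^ 2) ((π + z) ^ 2) (p 1 ^ 2) *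
          ((radialCutoffC (1 / 2) (momToComplex p) * sectorWeightCirc n₁ ((ω₁ : ℕ) : ℤ) (polarAngle p)) *
            (radialCutoffC (1 / 2) (momToComplex p) * sectorWeightCirc n₂ ((ω₂ : ℕ) : ℤ) (polarAngle p)))) p‖ ≤ z₂) := by
  classical
  have h := fun (ω₁ : Fin (sectorCount n₁)) (ω₂ : Fin (sectorCount n₂)) =>
    exists_angularFactor_derivBounds (n₁ := n₁) (n₂ := n₂) (ω₁ := ((ω₁ : ℕ) : ℤ)) (ω₂ := ((ω₂ : ℕ) : ℤ))
      (Z := fun p : Fin 2 → ℝ =>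
          gnCutoff ((π + z) ^ 2 / π ^ 2) ((π + z) ^ 2) (p 0 ^ 2) * gnCutoff ((π + z) ^ 2 / π ^ 2) ((π + z) ^ 2) (p 1 ^ 2) *
          ((radialCutoffC (1 / 2) (momToComplex p) * sectorWeightCirc n₁ ((ω₁ : ℕ) : ℤ) (polarAngle p)) *
            (radialCutoffC (1 / 2) (momToComplex p) * sectorWeightCirc n₂ ((ω₂ : ℕ) : ℤ) (polarAngle p)))) (fun _ => rfl) hz
  choose f₁ f₂ hf₁0 hf₂0 hf₁ hf₂ using h
  refine ⟨∑ ω₁, ∑ ω₂, f₁ ω₁ ω₂, ∑ ω₁, ∑ ω₂, f₂ ω₁ ω₂,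
    Finset.sum_nonneg fun _ _ => Finset.sum_nonneg fun _ _ => hf₁0 _ _,
    Finset.sum_nonneg fun _ _ => Finset.sum_nonneg fun _ _ => hf₂0 _ _, fun ω₁ ω₂ p => ?_, fun ω₁ ω₂ p => ?_⟩
  · refine (hf₁ ω₁ ω₂ p).trans (le_trans ?_ (Finset.single_le_sum (f := fun ω => ∑ ω', f₁ ω ω')
      (fun _ _ => Finset.sum_nonneg fun _ _ => hf₁0 _ _) (Finset.mem_univ ω₁)))
    exact Finset.single_le_sum (f := fun ω' => f₁ ω₁ ω') (fun _ _ => hf₁0 _ _) (Finset.mem_univ ω₂)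
  · refine (hf₂ ω₁ ω₂ p).trans (le_trans ?_ (Finset.single_le_sum (f := fun ω => ∑ ω', f₂ ω ω')
      (fun _ _ => Finset.sum_nonneg fun _ _ => hf₂0 _ _) (Finset.mem_univ ω₁)))
    exact Finset.single_le_sum (f := fun ω' => f₂ ω₁ ω') (fun _ _ => hf₂0 _ _) (Finset.mem_univ ω₂)

/-! ## §3 The thin-pair `ℓ¹` bound at the canonical rates: linear in `ε`, counting factor `≤ (2M+1)·L²` -/

/-- **The amplitude of `sum_norm_charSum_thinPairDiff_le` at the canonical rates is exactly linear in `ε`**, coefficient `(L, M)`-free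
(after the cancellations `(2π/L)²/(4/L)² = (2π)²/4²` and `4/(s₀·2M) = 4` at `s₀ = 1/(2M)`); `G₁ G₂ G₃ E` abstract the profile constants. [folklore] -/
theorem thinPairDiff_amp_linear (Λ A E β G₁ G₂ G₃ z₁ z₂ ε : ℝ) :
    (G₁ / Λ ^ 2 * (2 * E * ε * 1) +
          (4 * (G₃ / Λ ^ 2) +
              2 * (G₂ / Λ ^ 2)) *
            (2 * π / β) ^ 2 * (2 * E * ε * 1) / Λ ^ 2 / (4 / 1) ^ 2 +
          (2 * π) ^ 2 / 4 ^ 2 *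
            (((4 * (G₃ /
                    Λ ^ 2) +
                  2 * (G₂ / Λ ^ 2)) *
                  (4 + 2 * A) ^ 2 / Λ ^ 2 +
                2 * (G₂ / Λ ^ 2) * (4 + 4 * A) /
                  Λ) * (2 * E * ε * 1) +
              4 * (G₂ / Λ ^ 2) * (4 + 2 * A) /
                  Λ * (2 * (((4 + 2 * A) * ε + E * (2 * ε)) * 1 + E * ε * z₁)) +
              G₁ / Λ ^ 2 *
                (2 * (((4 + 4 * A) * ε + 2 * (4 + 2 * A) * (2 * ε) + E * (4 * ε)) * 1 +
                  2 * ((4 + 2 * A) * ε + E * (2 * ε)) * z₁ + E * ε * z₂)))) =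
      (G₁ / Λ ^ 2 * (2 * E * 1 * 1) +
          (4 * (G₃ / Λ ^ 2) +
              2 * (G₂ / Λ ^ 2)) *
            (2 * π / β) ^ 2 * (2 * E * 1 * 1) / Λ ^ 2 / 16 +
          (2 * π) ^ 2 / 4 ^ 2 *
            (((4 * (G₃ /
                    Λ ^ 2) +
                  2 * (G₂ / Λ ^ 2)) *
                  (4 + 2 * A) ^ 2 / Λ ^ 2 +
                2 * (G₂ / Λ ^ 2) * (4 + 4 * A) /
                  Λ) * (2 * E * 1 * 1) +
              4 * (G₂ / Λ ^ 2) * (4 + 2 * A) /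
                  Λ * (2 * (((4 + 2 * A) * 1 + E * (2 * 1)) * 1 + E * 1 * z₁)) +
              G₁ / Λ ^ 2 *
                (2 * (((4 + 4 * A) * 1 + 2 * (4 + 2 * A) * (2 * 1) + E * (4 * 1)) * 1 +
                  2 * ((4 + 2 * A) * 1 + E * (2 * 1)) * z₁ + E * 1 * z₂)))) * ε := by
  ring

/-- **RATE CORE of the thin-pair `ℓ¹` bound.**  For fixed data `(Λ, s_max, D_t, ρ_min, w, A, μ, e₀, β, d, z₁, z₂)` there is `P ≥ 0` such that for
every `L ≥ 1`, `2M ≥ 1`, `ε ≥ 0` (and the listed sign conditions) the right-hand side of `…FrameDiffsL1.sum_norm_charSum_thinPairDiff_le` at the rates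
`s₀ := 1/(2M)`, `s₁ := 1` is `≤ P·((2M+1)·L²)·ε` (counting factor `≤ √(32768·c₁·N₁)·(2M+1)·L²` as `N̄_s ≤ L²·N₁`; amplitude `= A₁·ε`). [folklore] -/
theorem thinPairDiff_rate_core (Λ sm Dt rm w A μ e₀ β d z₁ z₂ : ℝ) :
    ∃ P : ℝ, 0 ≤ P ∧ ∀ (Lr M₂ ε : ℝ), 1 ≤ Lr → 1 ≤ M₂ → 0 < Λ → 0 < sm * Dt → 0 < w → 0 ≤ A → 0 < Dt - 2 * A →
      0 < 2 * rm - 4 * A → 0 < e₀ → 0 < β → 0 ≤ d → 0 ≤ z₁ → 0 ≤ z₂ → 0 ≤ ε →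
      Real.sqrt (2048 * (1 / (1 / M₂) + 1) * (4 * ((2 * Real.sqrt 2 / (1 : ℝ) + 2) * (2 * Real.sqrt 2 / (1 : ℝ) + 2)) + 16 * (1 / (1 : ℝ) + 1) ^ 2)) *
        Real.sqrt (16 * M₂ * Lr ^ 2 *
          (2 * ((Λ * β / π + 1) *
            ((Real.sqrt 2 * Lr * ((Λ + (4 + 4 * A) *
                ((Λ + sm * Dt * (3 * w / 4)) / (Dt - 2 * A)) ^ 2) / (2 * rm - 4 * A)) / π + 2) *
              (Real.sqrt 2 * Lr * (2 * ((Λ + sm * Dt * (3 * w / 4)) / (Dt - 2 * A))) / π + 2))))) *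
        ((d * e₀ ^ 2 * 1 + 1 * (d * e₀ ^ 2)) / Λ ^ 2 * (2 * (4 + A + |μ|) * ε * 1) +
          (4 * ((d * e₀ ^ 6 * 1 + 3 * (d * e₀ ^ 4) * (d * e₀ ^ 2) + 3 * (d * e₀ ^ 2) * (d * e₀ ^ 4) + 1 * (d * e₀ ^ 6)) / Λ ^ 2) +
              2 * ((d * e₀ ^ 4 * 1 + 2 * (d * e₀ ^ 2) * (d * e₀ ^ 2) + 1 * (d * e₀ ^ 4)) / Λ ^ 2)) *
            (2 * π / β) ^ 2 * (2 * (4 + A + |μ|) * ε * 1) / Λ ^ 2 / (4 / ((1 / M₂) * M₂)) ^ 2 +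
          (2 * π / Lr) ^ 2 *
            (((4 * ((d * e₀ ^ 6 * 1 + 3 * (d * e₀ ^ 4) * (d * e₀ ^ 2) + 3 * (d * e₀ ^ 2) * (d * e₀ ^ 4) + 1 * (d * e₀ ^ 6)) /
                    Λ ^ 2) +
                  2 * ((d * e₀ ^ 4 * 1 + 2 * (d * e₀ ^ 2) * (d * e₀ ^ 2) + 1 * (d * e₀ ^ 4)) / Λ ^ 2)) *
                  (4 + 2 * A) ^ 2 / Λ ^ 2 +
                2 * ((d * e₀ ^ 4 * 1 + 2 * (d * e₀ ^ 2) * (d * e₀ ^ 2) + 1 * (d * e₀ ^ 4)) / Λ ^ 2) * (4 + 4 * A) /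
                  Λ) * (2 * (4 + A + |μ|) * ε * 1) +
              4 * ((d * e₀ ^ 4 * 1 + 2 * (d * e₀ ^ 2) * (d * e₀ ^ 2) + 1 * (d * e₀ ^ 4)) / Λ ^ 2) * (4 + 2 * A) /
                  Λ * (2 * (((4 + 2 * A) * ε + (4 + A + |μ|) * (2 * ε)) * 1 + (4 + A + |μ|) * ε * z₁)) +
              (d * e₀ ^ 2 * 1 + 1 * (d * e₀ ^ 2)) / Λ ^ 2 *
                (2 * (((4 + 4 * A) * ε + 2 * (4 + 2 * A) * (2 * ε) + (4 + A + |μ|) * (4 * ε)) * 1 +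
                  2 * ((4 + 2 * A) * ε + (4 + A + |μ|) * (2 * ε)) * z₁ + (4 + A + |μ|) * ε * z₂))) /
            (4 / ((1 : ℝ) * Lr)) ^ 2) ≤
      P * ((M₂ + 1) * Lr ^ 2) * ε := by
  refine ⟨|Real.sqrt (32768 * (4 * ((2 * Real.sqrt 2 / (1 : ℝ) + 2) * (2 * Real.sqrt 2 / (1 : ℝ) + 2)) + 16 * (1 / (1 : ℝ) + 1) ^ 2) *
      (2 * ((Λ * β / π + 1) *
            ((Real.sqrt 2 * ((Λ + (4 + 4 * A) *
                ((Λ + sm * Dt * (3 * w / 4)) / (Dt - 2 * A)) ^ 2) / (2 * rm - 4 * A)) / π + 2) *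
              (Real.sqrt 2 * (2 * ((Λ + sm * Dt * (3 * w / 4)) / (Dt - 2 * A))) / π + 2))))) *
    ((d * e₀ ^ 2 * 1 + 1 * (d * e₀ ^ 2)) / Λ ^ 2 * (2 * (4 + A + |μ|) * 1 * 1) +
          (4 * ((d * e₀ ^ 6 * 1 + 3 * (d * e₀ ^ 4) * (d * e₀ ^ 2) + 3 * (d * e₀ ^ 2) * (d * e₀ ^ 4) + 1 * (d * e₀ ^ 6)) / Λ ^ 2) +
              2 * ((d * e₀ ^ 4 * 1 + 2 * (d * e₀ ^ 2) * (d * e₀ ^ 2) + 1 * (d * e₀ ^ 4)) / Λ ^ 2)) *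
            (2 * π / β) ^ 2 * (2 * (4 + A + |μ|) * 1 * 1) / Λ ^ 2 / 16 +
          (2 * π) ^ 2 / 4 ^ 2 *
            (((4 * ((d * e₀ ^ 6 * 1 + 3 * (d * e₀ ^ 4) * (d * e₀ ^ 2) + 3 * (d * e₀ ^ 2) * (d * e₀ ^ 4) + 1 * (d * e₀ ^ 6)) /
                    Λ ^ 2) +
                  2 * ((d * e₀ ^ 4 * 1 + 2 * (d * e₀ ^ 2) * (d * e₀ ^ 2) + 1 * (d * e₀ ^ 4)) / Λ ^ 2)) *
                  (4 + 2 * A) ^ 2 / Λ ^ 2 +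
                2 * ((d * e₀ ^ 4 * 1 + 2 * (d * e₀ ^ 2) * (d * e₀ ^ 2) + 1 * (d * e₀ ^ 4)) / Λ ^ 2) * (4 + 4 * A) /
                  Λ) * (2 * (4 + A + |μ|) * 1 * 1) +
              4 * ((d * e₀ ^ 4 * 1 + 2 * (d * e₀ ^ 2) * (d * e₀ ^ 2) + 1 * (d * e₀ ^ 4)) / Λ ^ 2) * (4 + 2 * A) /
                  Λ * (2 * (((4 + 2 * A) * 1 + (4 + A + |μ|) * (2 * 1)) * 1 + (4 + A + |μ|) * 1 * z₁)) +
              (d * e₀ ^ 2 * 1 + 1 * (d * e₀ ^ 2)) / Λ ^ 2 *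
                (2 * (((4 + 4 * A) * 1 + 2 * (4 + 2 * A) * (2 * 1) + (4 + A + |μ|) * (4 * 1)) * 1 +
                  2 * ((4 + 2 * A) * 1 + (4 + A + |μ|) * (2 * 1)) * z₁ + (4 + A + |μ|) * 1 * z₂))))|, abs_nonneg _, ?_⟩
  intro Lr M₂ ε hL1 hM1 hΛ hsD hw hA0 hDt hrm he hβ hd hz₁ hz₂ hε
  have hL0 : 0 < Lr := by linarith
  have hM0 : 0 < M₂ := by linarith
  -- the two cancellations and the linearity of the amplitude
  have hs : 1 / M₂ * M₂ = 1 := by rw [one_div, inv_mul_cancel₀ hM0.ne']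
  have hT3 : ∀ X : ℝ, (2 * π / Lr) ^ 2 * X / (4 / ((1 : ℝ) * Lr)) ^ 2 = (2 * π) ^ 2 / 4 ^ 2 * X := fun X => by
    field_simp
  rw [hT3, hs, one_div_one_div, thinPairDiff_amp_linear]
  -- abbreviations (every long scalar is written once)
  set c₁ : ℝ := (4 * ((2 * Real.sqrt 2 / (1 : ℝ) + 2) * (2 * Real.sqrt 2 / (1 : ℝ) + 2)) + 16 * (1 / (1 : ℝ) + 1) ^ 2) with hc₁
  set N₁ : ℝ := (2 * ((Λ * β / π + 1) *
            ((Real.sqrt 2 * ((Λ + (4 + 4 * A) *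
                ((Λ + sm * Dt * (3 * w / 4)) / (Dt - 2 * A)) ^ 2) / (2 * rm - 4 * A)) / π + 2) *
              (Real.sqrt 2 * (2 * ((Λ + sm * Dt * (3 * w / 4)) / (Dt - 2 * A))) / π + 2)))) with hN₁
  set Nb : ℝ := (2 * ((Λ * β / π + 1) *
            ((Real.sqrt 2 * Lr * ((Λ + (4 + 4 * A) *
                ((Λ + sm * Dt * (3 * w / 4)) / (Dt - 2 * A)) ^ 2) / (2 * rm - 4 * A)) / π + 2) *
              (Real.sqrt 2 * Lr * (2 * ((Λ + sm * Dt * (3 * w / 4)) / (Dt - 2 * A))) / π + 2)))) with hNb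
  set A₁ : ℝ := ((d * e₀ ^ 2 * 1 + 1 * (d * e₀ ^ 2)) / Λ ^ 2 * (2 * (4 + A + |μ|) * 1 * 1) +
          (4 * ((d * e₀ ^ 6 * 1 + 3 * (d * e₀ ^ 4) * (d * e₀ ^ 2) + 3 * (d * e₀ ^ 2) * (d * e₀ ^ 4) + 1 * (d * e₀ ^ 6)) / Λ ^ 2) +
              2 * ((d * e₀ ^ 4 * 1 + 2 * (d * e₀ ^ 2) * (d * e₀ ^ 2) + 1 * (d * e₀ ^ 4)) / Λ ^ 2)) *
            (2 * π / β) ^ 2 * (2 * (4 + A + |μ|) * 1 * 1) / Λ ^ 2 / 16 +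
          (2 * π) ^ 2 / 4 ^ 2 *
            (((4 * ((d * e₀ ^ 6 * 1 + 3 * (d * e₀ ^ 4) * (d * e₀ ^ 2) + 3 * (d * e₀ ^ 2) * (d * e₀ ^ 4) + 1 * (d * e₀ ^ 6)) /
                    Λ ^ 2) +
                  2 * ((d * e₀ ^ 4 * 1 + 2 * (d * e₀ ^ 2) * (d * e₀ ^ 2) + 1 * (d * e₀ ^ 4)) / Λ ^ 2)) *
                  (4 + 2 * A) ^ 2 / Λ ^ 2 +
                2 * ((d * e₀ ^ 4 * 1 + 2 * (d * e₀ ^ 2) * (d * e₀ ^ 2) + 1 * (d * e₀ ^ 4)) / Λ ^ 2) * (4 + 4 * A) /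
                  Λ) * (2 * (4 + A + |μ|) * 1 * 1) +
              4 * ((d * e₀ ^ 4 * 1 + 2 * (d * e₀ ^ 2) * (d * e₀ ^ 2) + 1 * (d * e₀ ^ 4)) / Λ ^ 2) * (4 + 2 * A) /
                  Λ * (2 * (((4 + 2 * A) * 1 + (4 + A + |μ|) * (2 * 1)) * 1 + (4 + A + |μ|) * 1 * z₁)) +
              (d * e₀ ^ 2 * 1 + 1 * (d * e₀ ^ 2)) / Λ ^ 2 *
                (2 * (((4 + 4 * A) * 1 + 2 * (4 + 2 * A) * (2 * 1) + (4 + A + |μ|) * (4 * 1)) * 1 +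
                  2 * ((4 + 2 * A) * 1 + (4 + A + |μ|) * (2 * 1)) * z₁ + (4 + A + |μ|) * 1 * z₂)))) with hA₁
  have hc₁0 : 0 ≤ c₁ := by rw [hc₁]; positivity
  have hA₁0 : 0 ≤ A₁ := by rw [hA₁]; positivity
  -- the geometric sizes are nonnegative
  have hρ₁ : 0 ≤ (Λ + sm * Dt * (3 * w / 4)) / (Dt - 2 * A) :=
    div_nonneg (add_nonneg hΛ.le (mul_nonneg hsD.le (by positivity))) hDt.le
  have hX₁ : 0 ≤ (Λ + (4 + 4 * A) * ((Λ + sm * Dt * (3 * w / 4)) / (Dt - 2 * A)) ^ 2) / (2 * rm - 4 * A) :=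
    div_nonneg (add_nonneg hΛ.le (mul_nonneg (by positivity) (sq_nonneg _))) hrm.le
  have hX₂ : 0 ≤ 2 * ((Λ + sm * Dt * (3 * w / 4)) / (Dt - 2 * A)) := mul_nonneg zero_le_two hρ₁
  -- `N̄_s ≤ L²·N₁` for `L ≥ 1`
  have hf : ∀ X : ℝ, 0 ≤ X → Real.sqrt 2 * Lr * X / π + 2 ≤ Lr * (Real.sqrt 2 * X / π + 2) := by
    intro X hX
    have h : Lr * (Real.sqrt 2 * X / π + 2) - (Real.sqrt 2 * Lr * X / π + 2) = 2 * (Lr - 1) := by ring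
    linarith
  have hNb0 : 0 ≤ Nb := by rw [hNb]; positivity
  have hNb_le : Nb ≤ Lr ^ 2 * N₁ := by
    have h1 := hf _ hX₁
    have h2 := hf _ hX₂
    rw [hNb, hN₁]
    calc (2 * ((Λ * β / π + 1) *
            ((Real.sqrt 2 * Lr * ((Λ + (4 + 4 * A) *
                ((Λ + sm * Dt * (3 * w / 4)) / (Dt - 2 * A)) ^ 2) / (2 * rm - 4 * A)) / π + 2) *
              (Real.sqrt 2 * Lr * (2 * ((Λ + sm * Dt * (3 * w / 4)) / (Dt - 2 * A))) / π + 2))))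
        ≤ 2 * ((Λ * β / π + 1) *
            ((Lr * (Real.sqrt 2 * ((Λ + (4 + 4 * A) * ((Λ + sm * Dt * (3 * w / 4)) / (Dt - 2 * A)) ^ 2) / (2 * rm - 4 * A)) / π + 2)) *
              (Lr * (Real.sqrt 2 * (2 * ((Λ + sm * Dt * (3 * w / 4)) / (Dt - 2 * A))) / π + 2)))) := by
          gcongr
      _ = Lr ^ 2 * (2 * ((Λ * β / π + 1) *
            ((Real.sqrt 2 * ((Λ + (4 + 4 * A) *
                ((Λ + sm * Dt * (3 * w / 4)) / (Dt - 2 * A)) ^ 2) / (2 * rm - 4 * A)) / π + 2) *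
              (Real.sqrt 2 * (2 * ((Λ + sm * Dt * (3 * w / 4)) / (Dt - 2 * A))) / π + 2)))) := by ring
  have hN₁0 : 0 ≤ N₁ := nonneg_of_mul_nonneg_right (hNb0.trans hNb_le) (by positivity : (0 : ℝ) < Lr ^ 2)
  clear_value c₁ N₁ Nb A₁
  -- the counting factor
  have hQ : 0 ≤ Real.sqrt (32768 * c₁ * N₁) * ((M₂ + 1) * Lr ^ 2) := by positivity
  have hSW : Real.sqrt (2048 * (M₂ + 1) * c₁) * Real.sqrt (16 * M₂ * Lr ^ 2 * Nb) ≤ Real.sqrt (32768 * c₁ * N₁) * ((M₂ + 1) * Lr ^ 2) := by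
    rw [← Real.sqrt_mul (by positivity) (16 * M₂ * Lr ^ 2 * Nb), ← Real.sqrt_sq hQ]
    apply Real.sqrt_le_sqrt
    rw [mul_pow, Real.sq_sqrt (by positivity)]
    calc 2048 * (M₂ + 1) * c₁ * (16 * M₂ * Lr ^ 2 * Nb) = 32768 * c₁ * ((M₂ + 1) * Lr ^ 2) * (M₂ * Nb) := by ring
      _ ≤ 32768 * c₁ * ((M₂ + 1) * Lr ^ 2) * ((M₂ + 1) * (Lr ^ 2 * N₁)) :=
          mul_le_mul_of_nonneg_left (mul_le_mul (by linarith) hNb_le hNb0 (by linarith)) (by positivity)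
      _ = 32768 * c₁ * N₁ * ((M₂ + 1) * Lr ^ 2) ^ 2 := by ring
  -- assemble
  calc Real.sqrt (2048 * (M₂ + 1) * c₁) * Real.sqrt (16 * M₂ * Lr ^ 2 * Nb) * (A₁ * ε)
      ≤ Real.sqrt (32768 * c₁ * N₁) * ((M₂ + 1) * Lr ^ 2) * (A₁ * ε) := mul_le_mul_of_nonneg_right hSW (mul_nonneg hA₁0 hε)
    _ = Real.sqrt (32768 * c₁ * N₁) * A₁ * ((M₂ + 1) * Lr ^ 2) * ε := by ring
    _ ≤ |Real.sqrt (32768 * c₁ * N₁) * A₁| * ((M₂ + 1) * Lr ^ 2) * ε :=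
        mul_le_mul_of_nonneg_right (mul_le_mul_of_nonneg_right (le_abs_self _) (by positivity)) hε

section Frames

variable {a b : ℝ} (B : BandBounds a b) {A μ e₀ z β d : ℝ} (hADt : 2 * A < B.Dtmin)
  (he : 0 < e₀) (hz : 0 < z) (hz1 : z ≤ 1) (hgap : e₀ + A + z ^ 2 < -μ) (h3 : e₀ + A - μ ≤ 3)
  (hlo : a ≤ μ - A - e₀) (hhi : μ + A + e₀ ≤ b) (hβ : 0 < β) (hρA : 4 * A < 2 * B.rhomin)
  {n₁ n₂ : ℕ} (hn : n₂ + 1 ≤ n₁)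
  {d} (hd : 0 ≤ d) (hd1 : ∀ u, |deriv (bgmCutoffSq e₀) u| ≤ d) (hd2 : ∀ u, |iteratedDeriv 2 (bgmCutoffSq e₀) u| ≤ d)
  (hd3 : ∀ u, |iteratedDeriv 3 (bgmCutoffSq e₀) u| ≤ d)

include B hADt he hz hz1 hgap h3 hlo hhi hβ hρA hn hd hd1 hd2 hd3

/-- **THE `δ` OF THE RE-SECTORISATION FRAME DEFECT IS `O(ε)`, UNIFORMLY IN THE VOLUME AND IN THE NUMBER OF TIME SLICES.**  For the fixed one-volume
data `(β, B, e₀, z, μ, A, d)` and scales `n₂ + 1 ≤ n₁` there is `C ≥ 0` such that for ALL `L, M`, all frames `K, K′` with `‖D^j(K − ε₀)‖ ≤ A`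
(`j ≤ 2`), all `ε ≥ max_{j≤2} coeffNorm j (K′ ⊖ K)`, under the two eventual conditions `Λ_{n₁}β < π(2M−3)` and `2|2π/L| ≤ z`:
`imagTimeWeight β M · Σ_Y ‖Δ(Y′, Y)‖ ≤ C·ε` (pin rows) and `imagTimeWeight β M · Σ_{Y′} ‖Δ(Y′, Y)‖ ≤ C·ε` (columns) for
`Δ = E(klAniso[K′] n₁)·S(bgmFat[K′] n₂) − E(klAniso[K] n₁)·S(bgmFat[K] n₂)` — no rate, no angular size, no `M`-growth left.
[cite: BenfattoGiulianiMastropietro2006, §2.7 (2.71a); §3 (3.3)] -/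
theorem exists_overlapDefect_rate_of_frames :
    ∃ C : ℝ, 0 ≤ C ∧ ∀ (L M : ℕ) [NeZero L] [NeZero M] (K K' : TrigPolyC4v),
      (∀ p : Momentum, ∀ j ≤ 2, ‖iteratedFDeriv ℝ j (frameShift K) p‖ ≤ A) →
      (∀ p : Momentum, ∀ j ≤ 2, ‖iteratedFDeriv ℝ j (frameShift K') p‖ ≤ A) →
      klScale e₀ n₁ * β < π * (2 * M - 3) → 2 * |2 * π / (L : ℝ)| ≤ z →
      ∀ ε : ℝ, (∀ j ≤ 2, (fsub K' K).coeffNorm j ≤ ε) →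
        (∀ Y' : SpaceTimeIdx L M × SectorLeg (sectorCount n₁),
          imagTimeWeight β M * ∑ Y : SpaceTimeIdx L M × SectorLeg (sectorCount n₂),
            ‖(sectorAnalysisMatrix L M β (klAnisoFamily L M β μ K' e₀ n₁) *
              sectorSubMatrix L M β (bgmFatMultiplier L M e₀ β (nambuXiCT L μ K') n₂) -
              sectorAnalysisMatrix L M β (klAnisoFamily L M β μ K e₀ n₁) *
              sectorSubMatrix L M β (bgmFatMultiplier L M e₀ β (nambuXiCT L μ K) n₂)) Y' Y‖ ≤ C * ε) ∧
        (∀ Y : SpaceTimeIdx L M × SectorLeg (sectorCount n₂),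
          imagTimeWeight β M * ∑ Y' : SpaceTimeIdx L M × SectorLeg (sectorCount n₁),
            ‖(sectorAnalysisMatrix L M β (klAnisoFamily L M β μ K' e₀ n₁) *
              sectorSubMatrix L M β (bgmFatMultiplier L M e₀ β (nambuXiCT L μ K') n₂) -
              sectorAnalysisMatrix L M β (klAnisoFamily L M β μ K e₀ n₁) *
              sectorSubMatrix L M β (bgmFatMultiplier L M e₀ β (nambuXiCT L μ K) n₂)) Y' Y‖ ≤ C * ε) := by
  classical
  obtain ⟨z₁, z₂, hz₁0, hz₂0, hZ1, hZ2⟩ := exists_uniform_angularFactor_derivBounds hz n₁ n₂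
  obtain ⟨P, hP0, hP⟩ := thinPairDiff_rate_core (klScale e₀ n₁) B.smax B.Dtmin B.rhomin (sectorWidth n₂) A μ e₀ β d z₁ z₂
  refine ⟨324 * 2 ^ (n₁ - n₂) * P, by positivity, ?_⟩
  intro L M _ _ K K' hA hA' hM hzL ε hε
  have hn' : n₂ ≤ n₁ := by omega
  have hMpos : 0 < M := Nat.pos_of_ne_zero (NeZero.ne M)
  have hL : (0 : ℝ) < L := Nat.cast_pos.2 (Nat.pos_of_ne_zero (NeZero.ne L))
  have hL1 : (1 : ℝ) ≤ L := by exact_mod_cast Nat.pos_of_ne_zero (NeZero.ne L)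
  have hM21 : (1 : ℝ) ≤ ((2 * M : ℕ) : ℝ) := by exact_mod_cast (show 1 ≤ 2 * M by omega)
  have hM2 : (0 : ℝ) < ((2 * M : ℕ) : ℝ) := by linarith
  have hΛ : 0 < klScale e₀ n₁ := by rw [klScale]; positivity
  have hA0 : 0 ≤ A := le_trans (norm_nonneg _) (hA 0 0 (by norm_num))
  have hε0 : 0 ≤ ε := le_trans (TrigPolyC4v.coeffNorm_nonneg 0 _) (hε 0 (by norm_num))
  have hDt : 0 < B.Dtmin - 2 * A := by linarith
  have hρm : 0 < 2 * B.rhomin - 4 * A := by linarith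
  have hs₀ : (0 : ℝ) < 1 / ((2 * M : ℕ) : ℝ) := by positivity
  -- the thin-pair `ℓ¹` bound for every sector pair, at the canonical rates, through the rate core
  have hT0 : 0 ≤ P * ((((2 * M : ℕ) : ℝ) + 1) * (L : ℝ) ^ 2) * ε := by positivity
  have hT := fun (ω₁ : Fin (sectorCount n₁)) (ω₂ : Fin (sectorCount n₂)) =>
    (sum_norm_charSum_thinPairDiff_le B hA hA' hADt he hz hz1 hgap h3 hlo hhi hβ hρA hn' ω₁ ω₂ hd hd1 hd2 hd3
      (Z := fun p : Fin 2 → ℝ =>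
          gnCutoff ((π + z) ^ 2 / π ^ 2) ((π + z) ^ 2) (p 0 ^ 2) * gnCutoff ((π + z) ^ 2 / π ^ 2) ((π + z) ^ 2) (p 1 ^ 2) *
          ((radialCutoffC (1 / 2) (momToComplex p) * sectorWeightCirc n₁ ((ω₁ : ℕ) : ℤ) (polarAngle p)) *
            (radialCutoffC (1 / 2) (momToComplex p) * sectorWeightCirc n₂ ((ω₂ : ℕ) : ℤ) (polarAngle p)))) (fun _ => rfl) (hZ1 ω₁ ω₂) (hZ2 ω₁ ω₂) hε
      (Ds := fun q : TorusSite 1 (2 * M) × TorusSite 2 L =>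
        klAnisoFamily L M β μ K' e₀ n₁ ω₁ (⟨(q.1 0).val, ZMod.val_lt (q.1 0)⟩, q.2) *
            klAnisoFamily L M β μ K' e₀ n₂ ω₂ (⟨(q.1 0).val, ZMod.val_lt (q.1 0)⟩, q.2) -
          klAnisoFamily L M β μ K e₀ n₁ ω₁ (⟨(q.1 0).val, ZMod.val_lt (q.1 0)⟩, q.2) *
            klAnisoFamily L M β μ K e₀ n₂ ω₂ (⟨(q.1 0).val, ZMod.val_lt (q.1 0)⟩, q.2))
      (fun _ => rfl) hM hzL hs₀ one_pos).trans
    (hP (L : ℝ) ((2 * M : ℕ) : ℝ) ε hL1 hM21 hΛ (mul_pos B.smax_pos B.Dtmin_pos) (sectorWidth_pos n₂) hA0 hDt hρm he hβ hd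
      hz₁0 hz₂0 hε0)
  refine ⟨fun Y' => ?_, fun Y => ?_⟩
  · have h := fullRowSum_overlapDefect_le he hβ K K' hn hT0 hT Y'
    refine (mul_le_mul_of_nonneg_left h (imagTimeWeight_nonneg hβ.le M)).trans ?_
    refine overlapDefect_rate_final hMpos ?_ hβ hL hP0 hε0
    have h2 : (1 : ℝ) ≤ 2 ^ (n₁ - n₂) := one_le_pow₀ (by norm_num)
    push_cast
    linarith
  · have h := fullColSum_overlapDefect_le he hβ K K' hn hT0 hT Y
    refine (mul_le_mul_of_nonneg_left h (imagTimeWeight_nonneg hβ.le M)).trans ?_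
    refine overlapDefect_rate_final hMpos ?_ hβ hL hP0 hε0
    push_cast
    linarith

/-- **THE SAME IN THE SUBSTITUTION-LIPSCHITZ CURRENCY** (`TwoVolumeDefect.sum_pinned_norm_kernel_map_sub_map_le`, hypotheses `hδcol`, `hδrow`):
with `T[K] := ((imagTimeWeight β M : ℝ) : ℂ) • (E(klAniso[K] n₁)·S(bgmFat[K] n₂))` (the re-sectorisation of
`sector_sum_norm_kernel_twoVolume_scaleSucc_le`, `hTf`), `∃ C ≥ 0` free of `(L, M, K, K′)` with
`∀ y, Σ_x ‖T[K′] x y − T[K] x y‖ ≤ C·ε` and `∀ w, Σ_y ‖T[K′] w y − T[K] w y‖ ≤ C·ε` under the same two eventual conditions.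
[cite: BenfattoGiulianiMastropietro2006, §2.7 (2.71a); §3 (3.3)] -/
theorem exists_transfer_frameDefect_rate :
    ∃ C : ℝ, 0 ≤ C ∧ ∀ (L M : ℕ) [NeZero L] [NeZero M] (K K' : TrigPolyC4v),
      (∀ p : Momentum, ∀ j ≤ 2, ‖iteratedFDeriv ℝ j (frameShift K) p‖ ≤ A) →
      (∀ p : Momentum, ∀ j ≤ 2, ‖iteratedFDeriv ℝ j (frameShift K') p‖ ≤ A) →
      klScale e₀ n₁ * β < π * (2 * M - 3) → 2 * |2 * π / (L : ℝ)| ≤ z →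
      ∀ ε : ℝ, (∀ j ≤ 2, (fsub K' K).coeffNorm j ≤ ε) →
        (∀ Y : SpaceTimeIdx L M × SectorLeg (sectorCount n₂),
          ∑ Y' : SpaceTimeIdx L M × SectorLeg (sectorCount n₁),
            ‖(((imagTimeWeight β M : ℝ) : ℂ) • (sectorAnalysisMatrix L M β (klAnisoFamily L M β μ K' e₀ n₁) *
              sectorSubMatrix L M β (bgmFatMultiplier L M e₀ β (nambuXiCT L μ K') n₂))) Y' Y -
              (((imagTimeWeight β M : ℝ) : ℂ) • (sectorAnalysisMatrix L M β (klAnisoFamily L M β μ K e₀ n₁) *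
              sectorSubMatrix L M β (bgmFatMultiplier L M e₀ β (nambuXiCT L μ K) n₂))) Y' Y‖ ≤ C * ε) ∧
        (∀ Y' : SpaceTimeIdx L M × SectorLeg (sectorCount n₁),
          ∑ Y : SpaceTimeIdx L M × SectorLeg (sectorCount n₂),
            ‖(((imagTimeWeight β M : ℝ) : ℂ) • (sectorAnalysisMatrix L M β (klAnisoFamily L M β μ K' e₀ n₁) *
              sectorSubMatrix L M β (bgmFatMultiplier L M e₀ β (nambuXiCT L μ K') n₂))) Y' Y -
              (((imagTimeWeight β M : ℝ) : ℂ) • (sectorAnalysisMatrix L M β (klAnisoFamily L M β μ K e₀ n₁) *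
              sectorSubMatrix L M β (bgmFatMultiplier L M e₀ β (nambuXiCT L μ K) n₂))) Y' Y‖ ≤ C * ε) := by
  obtain ⟨C, hC0, hC⟩ := exists_overlapDefect_rate_of_frames B hADt he hz hz1 hgap h3 hlo hhi hβ hρA hn hd hd1 hd2 hd3
  refine ⟨C, hC0, fun L M _ _ K K' hA hA' hM hzL ε hε => ?_⟩
  obtain ⟨hrow, hcol⟩ := hC L M K K' hA hA' hM hzL ε hε
  refine ⟨fun Y => ?_, fun Y' => ?_⟩
  · simp only [norm_real_smul_apply_sub _ _ (imagTimeWeight_nonneg hβ.le M), ← Finset.mul_sum]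
    exact hcol Y
  · simp only [norm_real_smul_apply_sub _ _ (imagTimeWeight_nonneg hβ.le M), ← Finset.mul_sum]
    exact hrow Y'

end Frames

end Summit.HubbardSuperconductivity.HubbardSuperconductivity.Theorems.TorusFourierL2

end
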